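import Literature.Geometry.Lorentzian.CoordBoundaryCoercivityIntegrals
import Mathlib.Analysis.SpecialFunctions.SmoothTransition
import HarnessLib

/-!
# Cut-off functions adapted to a boundary collar, and pointwise splitting inequalities

Topic `Literature/Geometry/Lorentzian`, coordinate tensor calculus `MetricCoord`. Everything here is
PROVED; no definition and no statement of `Prop` type is introduced.

The proof of the coercivity inequality (3.5) of Chruściel–Delay (Mém. SMF 94 (2003), Prop. 3.3)
splits a pair `(N, Y)` compactly supported in the domain `M = {x > 0}` as
`(N, Y) = (χN, χY) + ((1 − χ)N, (1 − χ)Y)` with a cut-off `χ = η ∘ x` equal to `1` near the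
boundary (`x ≤ x₀/2`) and to `0` away from it (`x ≥ 3x₀/4`), applies the boundary estimate (3.4)
to the first piece and the interior elliptic estimate to the second, and recombines. This file
provides the elementary ingredients of that localisation:

* `exists_collarCutoff` — for `x` smooth on an open `V` and `x₀ > 0` a function `χ`, smooth on
  `V`, with values in `[0, 1]`, `χ = 1` on `{x ≤ x₀/2}`, `χ = 0` on `{3x₀/4 ≤ x}`, and locally
  constant (`1`, resp. `0`) near the points of `{x < x₀/2}`, resp. `{3x₀/4 < x}`
  (`χ = smoothTransition ((3x₀/4 − x)/(x₀/4))`);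
* `tsupport_cutoff_mul_subset_collar`, `tsupport_cutoff_smul_subset_collar` — `χN`, `χY` are
  supported in the collar `{0 < x < x₀}` when `N`, `Y` are supported in `{0 < x}`;
* `fderiv_eq_zero_of_eventuallyEq_const`, `gradSqAt_eq_zero_of_eventuallyEq_const`,
  `hessAt_eq_zero_of_eventuallyEq_const`, `lapAt_eq_zero_of_eventuallyEq_const` — derivatives of a
  locally constant function vanish;
* `IsMetricOn.metric_add_le`, `IsMetricOn.gradSqAt_nonneg`, `IsMetricOn.gradSqAt_add_le` — the
  splitting inequalities `|v + w|² ≤ 2|v|² + 2|w|²`, `0 ≤ |∇f|²`, `|∇(f+g)|² ≤ 2|∇f|² + 2|∇g|²` at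
  positive definite points (the companions `normSqAt_add_le`, `IsMetricOn.mtrAt_bilinearComp_add_le`
  are in the tree);
* `exp_weight_le_of_le`, `pow_weight_mul_exp_ge` — comparison of the weights `e^{2σ/x}`, `x^k` with
  constants on `{x₀/2 ≤ x}`.

## References

* P. T. Chruściel, E. Delay, Mém. Soc. Math. Fr. 94 (2003), §3 (proof of Prop. 3.1/3.3).
  [ChruscielDelay2003]
* B. O'Neill, Semi-Riemannian geometry (1983), Ch. 3. [ONeill1983]
-/

noncomputable section

set_option maxSynthPendingDepth 3

open Set Filter Module Function
open scoped Topology ContDiff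

namespace Literature.Geometry.Lorentzian

namespace MetricCoord

variable {E : Type*} [NormedAddCommGroup E] [NormedSpace ℝ E]
  {G : E → E →L[ℝ] E →L[ℝ] ℝ} {V : Set E} {x : E} {xf χ N : E → ℝ} {Y : E → E}

/-! ### The cut-off -/

/-- **A cut-off adapted to the collar.** For `x` smooth on an open set `V` and `x₀ > 0` there is
`χ` smooth on `V` with `0 ≤ χ ≤ 1`, `χ = 1` where `x ≤ x₀/2`, `χ = 0` where `3x₀/4 ≤ x`, locally
equal to `1` near the points of `V` with `x < x₀/2` and locally equal to `0` near the points of `V`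
with `3x₀/4 < x` (take `χ = smoothTransition ((3x₀/4 − x)/(x₀/4))`).
[cite: ChruscielDelay2003, §3 (proof of Prop. 3.1)] -/
theorem exists_collarCutoff (hV : IsOpen V) (hxf : ContDiffOn ℝ ∞ xf V) {x₀ : ℝ} (hx₀ : 0 < x₀) :
    ∃ χ : E → ℝ, ContDiffOn ℝ ∞ χ V ∧ (∀ y, 0 ≤ χ y ∧ χ y ≤ 1) ∧
      (∀ y, xf y ≤ x₀ / 2 → χ y = 1) ∧ (∀ y, 3 * x₀ / 4 ≤ xf y → χ y = 0) ∧
      (∀ y ∈ V, xf y < x₀ / 2 → χ =ᶠ[𝓝 y] fun _ ↦ 1) ∧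
      (∀ y ∈ V, 3 * x₀ / 4 < xf y → χ =ᶠ[𝓝 y] fun _ ↦ 0) := by
  set χ : E → ℝ := fun y ↦ Real.smoothTransition ((3 * x₀ / 4 - xf y) / (x₀ / 4)) with hχ
  have hx4 : 0 < x₀ / 4 := by positivity
  have h1 : ∀ y, xf y ≤ x₀ / 2 → χ y = 1 := by
    intro y hy
    refine Real.smoothTransition.one_of_one_le ?_
    rw [le_div_iff₀ hx4]
    linarith
  have h0 : ∀ y, 3 * x₀ / 4 ≤ xf y → χ y = 0 := by
    intro y hy
    refine Real.smoothTransition.zero_of_nonpos ?_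
    exact div_nonpos_of_nonpos_of_nonneg (by linarith) hx4.le
  have hcont : ContinuousOn xf V := hxf.continuousOn
  refine ⟨χ, ?_, fun y ↦ ⟨Real.smoothTransition.nonneg _, Real.smoothTransition.le_one _⟩, h1, h0,
    ?_, ?_⟩
  · have harg : ContDiffOn ℝ ∞ (fun y ↦ (3 * x₀ / 4 - xf y) / (x₀ / 4)) V :=
      (contDiffOn_const.sub hxf).div_const _
    exact Real.smoothTransition.contDiff.comp_contDiffOn harg
  · intro y hy hlt
    have hev : ∀ᶠ z in 𝓝 y, xf z < x₀ / 2 := by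
      have hct : ContinuousAt xf y := (hcont.continuousWithinAt hy).continuousAt (hV.mem_nhds hy)
      exact hct.eventually (gt_mem_nhds hlt)
    filter_upwards [hev] with z hz
    exact h1 z hz.le
  · intro y hy hlt
    have hev : ∀ᶠ z in 𝓝 y, 3 * x₀ / 4 < xf z := by
      have hct : ContinuousAt xf y := (hcont.continuousWithinAt hy).continuousAt (hV.mem_nhds hy)
      exact hct.eventually (lt_mem_nhds hlt)
    filter_upwards [hev] with z hz
    exact h0 z hz.le

/-! ### Supports of the cut-off pieces -/

omit [NormedSpace ℝ E] in
/-- If `N` is supported in `{y ∈ V | 0 < x}` and `χ` vanishes near every point of `V` with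
`3x₀/4 < x`, then `χN` is supported in the collar `{y ∈ V | 0 < x < x₀}`.
[cite: ChruscielDelay2003, §3 (proof of Prop. 3.1)] -/
theorem tsupport_cutoff_mul_subset_collar {x₀ : ℝ}
    (hχ0 : ∀ y ∈ V, 3 * x₀ / 4 < xf y → χ =ᶠ[𝓝 y] fun _ ↦ 0)
    (hN : tsupport N ⊆ {y ∈ V | 0 < xf y}) :
    tsupport (fun y ↦ χ y * N y) ⊆ {y ∈ V | 0 < xf y ∧ xf y < x₀} := by
  intro y hy
  have hyN : y ∈ tsupport N := tsupport_mul_subset_right hy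
  obtain ⟨hyV, hpos⟩ := hN hyN
  refine ⟨hyV, hpos, ?_⟩
  by_contra hge
  have hlt : 3 * x₀ / 4 < xf y := by linarith [not_lt.mp hge]
  have hev : (fun y ↦ χ y * N y) =ᶠ[𝓝 y] fun _ ↦ 0 := by
    filter_upwards [hχ0 y hyV hlt] with z hz
    rw [hz, zero_mul]
  exact (notMem_tsupport_iff_eventuallyEq.mpr hev) hy

/-- If `Y` is supported in `{y ∈ V | 0 < x}` and `χ` vanishes near every point of `V` with
`3x₀/4 < x`, then `χ • Y` is supported in the collar `{y ∈ V | 0 < x < x₀}`.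
[cite: ChruscielDelay2003, §3 (proof of Prop. 3.1)] -/
theorem tsupport_cutoff_smul_subset_collar {x₀ : ℝ}
    (hχ0 : ∀ y ∈ V, 3 * x₀ / 4 < xf y → χ =ᶠ[𝓝 y] fun _ ↦ 0)
    (hY : tsupport Y ⊆ {y ∈ V | 0 < xf y}) :
    tsupport (fun y ↦ χ y • Y y) ⊆ {y ∈ V | 0 < xf y ∧ xf y < x₀} := by
  intro y hy
  have hyY : y ∈ tsupport Y := tsupport_smul_subset_right (fun y ↦ χ y) Y hy
  obtain ⟨hyV, hpos⟩ := hY hyY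
  refine ⟨hyV, hpos, ?_⟩
  by_contra hge
  have hlt : 3 * x₀ / 4 < xf y := by linarith [not_lt.mp hge]
  have hev : (fun y ↦ χ y • Y y) =ᶠ[𝓝 y] fun _ ↦ 0 := by
    filter_upwards [hχ0 y hyV hlt] with z hz
    rw [hz, zero_smul]
  exact (notMem_tsupport_iff_eventuallyEq.mpr hev) hy

omit [NormedSpace ℝ E] in
/-- `tsupport (χ N) ⊆ tsupport N`. [folklore] -/
theorem tsupport_cutoff_mul_subset : tsupport (fun y ↦ χ y * N y) ⊆ tsupport N :=
  fun _ hy ↦ tsupport_mul_subset_right hy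

/-- `tsupport (χ • Y) ⊆ tsupport Y`. [folklore] -/
theorem tsupport_cutoff_smul_subset : tsupport (fun y ↦ χ y • Y y) ⊆ tsupport Y :=
  fun _ hy ↦ tsupport_smul_subset_right (fun y ↦ χ y) Y hy

omit [NormedSpace ℝ E] in
/-- `χ N` has compact support if `N` has. [folklore] -/
theorem hasCompactSupport_cutoff_mul (hN : HasCompactSupport N) :
    HasCompactSupport fun y ↦ χ y * N y :=
  hN.mul_left

/-- `χ • Y` has compact support if `Y` has. [folklore] -/
theorem hasCompactSupport_cutoff_smul (hY : HasCompactSupport Y) :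
    HasCompactSupport fun y ↦ χ y • Y y :=
  hY.smul_left

/-! ### Derivatives of locally constant functions -/

/-- `D f = 0` at a point near which `f` is constant. [folklore] -/
theorem fderiv_eq_zero_of_eventuallyEq_const {f : E → ℝ} {c : ℝ} (h : f =ᶠ[𝓝 x] fun _ ↦ c) :
    fderiv ℝ f x = 0 := by
  rw [h.fderiv_eq, fderiv_fun_const]; rfl

/-- `|∇f|² = 0` at a point near which `f` is constant. [folklore] -/
theorem gradSqAt_eq_zero_of_eventuallyEq_const {f : E → ℝ} {c : ℝ} (h : f =ᶠ[𝓝 x] fun _ ↦ c) :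
    gradSqAt G f x = 0 := by
  rw [gradSqAt_apply, fderiv_eq_zero_of_eventuallyEq_const h]; rfl

/-- `Hess f = 0` at a point near which `f` is constant. [folklore] -/
theorem hessAt_eq_zero_of_eventuallyEq_const {f : E → ℝ} {c : ℝ} (h : f =ᶠ[𝓝 x] fun _ ↦ c) :
    hessAt G f x = 0 := by
  rw [hessAt_congr_of_eventuallyEq G h]
  ext v w
  simp [hessAt_apply]

omit [NormedSpace ℝ E] in
/-- If `χ = 1` near `x` then `1 − χ = 0` near `x`. [folklore] -/
theorem eventuallyEq_one_sub_zero (h : χ =ᶠ[𝓝 x] fun _ ↦ 1) :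
    (fun y ↦ 1 - χ y) =ᶠ[𝓝 x] fun _ ↦ 0 := by
  filter_upwards [h] with z hz
  rw [hz, sub_self]

omit [NormedSpace ℝ E] in
/-- If `χ = c` near `x` then `χ N = c N` near `x`; in particular `χ N = 0` near `x` if `c = 0`.
[folklore] -/
theorem eventuallyEq_cutoff_mul_zero (h : χ =ᶠ[𝓝 x] fun _ ↦ 0) :
    (fun y ↦ χ y * N y) =ᶠ[𝓝 x] fun _ ↦ 0 := by
  filter_upwards [h] with z hz
  rw [hz, zero_mul]

/-- If `χ = 0` near `x` then `χ • Y = 0` near `x`. [folklore] -/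
theorem eventuallyEq_cutoff_smul_zero (h : χ =ᶠ[𝓝 x] fun _ ↦ 0) :
    (fun y ↦ χ y • Y y) =ᶠ[𝓝 x] fun _ ↦ 0 := by
  filter_upwards [h] with z hz
  rw [hz, zero_smul]

omit [NormedSpace ℝ E] in
/-- If `N = 0` near `x` then `χ N = 0` near `x`. [folklore] -/
theorem eventuallyEq_mul_zero_of_right (h : N =ᶠ[𝓝 x] fun _ ↦ 0) :
    (fun y ↦ χ y * N y) =ᶠ[𝓝 x] fun _ ↦ 0 := by
  filter_upwards [h] with z hz
  rw [hz, mul_zero]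

/-- If `Y = 0` near `x` then `χ • Y = 0` near `x`. [folklore] -/
theorem eventuallyEq_smul_zero_of_right (h : Y =ᶠ[𝓝 x] fun _ ↦ 0) :
    (fun y ↦ χ y • Y y) =ᶠ[𝓝 x] fun _ ↦ 0 := by
  filter_upwards [h] with z hz
  rw [hz, smul_zero]

/-! ### Splitting inequalities at positive definite points -/

section Split

variable [FiniteDimensional ℝ E]

/-- `Δ f = 0` at a point near which `f` is constant. [folklore] -/
theorem lapAt_eq_zero_of_eventuallyEq_const {f : E → ℝ} {c : ℝ} (h : f =ᶠ[𝓝 x] fun _ ↦ c) :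
    lapAt G f x = 0 := by
  rw [lapAt_congr_of_eventuallyEq G h]; exact lapAt_const G c

omit [FiniteDimensional ℝ E] in
/-- **`|v + w|² ≤ 2|v|² + 2|w|²`** for a positive semi-definite symmetric form.
[cite: ONeill1983, Ch. 3, pp. 60–61] -/
theorem IsMetricOn.metric_add_le (hG : IsMetricOn G V) (hx : x ∈ V)
    (hpos : ∀ v : E, v ≠ 0 → 0 < G x v v) (v w : E) :
    G x (v + w) (v + w) ≤ 2 * G x v v + 2 * G x w w := by
  have hs := hG.symm x hx
  have hnn : 0 ≤ G x (v - w) (v - w) := by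
    by_cases h : v - w = 0
    · rw [h]; simp
    · exact (hpos _ h).le
  have e1 : G x (v + w) (v + w) = G x v v + 2 * G x v w + G x w w := by
    simp only [map_add, _root_.add_apply, hs w v]; ring
  have e2 : G x (v - w) (v - w) = G x v v - 2 * G x v w + G x w w := by
    simp only [map_sub, _root_.sub_apply, hs w v]; ring
  linarith

/-- **`0 ≤ |∇f|²_G`** at a positive definite point (`|∇f|² = Σ_c (df(e_c))²`).
[cite: ONeill1983, Ch. 3, p. 85] -/
theorem IsMetricOn.gradSqAt_nonneg (hG : IsMetricOn G V) (hx : x ∈ V)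
    (hpos : ∀ v : E, v ≠ 0 → 0 < G x v v) (f : E → ℝ) : 0 ≤ gradSqAt G f x := by
  have hi := hG.isInvertible x hx
  have hs := hG.symm x hx
  obtain ⟨e, he⟩ := exists_orthonormal_basis hs hpos
  rw [gradSqAt_eq_sum_frame e he hi hs]
  exact Finset.sum_nonneg fun c _ ↦ sq_nonneg _

/-- **`|∇(f + g)|² ≤ 2|∇f|² + 2|∇g|²`** at a positive definite point.
[cite: ONeill1983, Ch. 3, p. 85] -/
theorem IsMetricOn.gradSqAt_add_le (hG : IsMetricOn G V) (hx : x ∈ V)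
    (hpos : ∀ v : E, v ≠ 0 → 0 < G x v v) {f g : E → ℝ} (hf : DifferentiableAt ℝ f x)
    (hg : DifferentiableAt ℝ g x) :
    gradSqAt G (fun y ↦ f y + g y) x ≤ 2 * gradSqAt G f x + 2 * gradSqAt G g x := by
  have hi := hG.isInvertible x hx
  have hs := hG.symm x hx
  obtain ⟨e, he⟩ := exists_orthonormal_basis hs hpos
  rw [gradSqAt_eq_sum_frame e he hi hs, gradSqAt_eq_sum_frame e he hi hs,
    gradSqAt_eq_sum_frame e he hi hs, Finset.mul_sum, Finset.mul_sum, ← Finset.sum_add_distrib]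
  refine Finset.sum_le_sum fun c _ ↦ ?_
  rw [fderiv_fun_add hf hg, _root_.add_apply]
  nlinarith [sq_nonneg (fderiv ℝ f x (e c) - fderiv ℝ g x (e c))]

omit [FiniteDimensional ℝ E] in
/-- `|∇(1 − χ)|² = |∇χ|²`. [folklore] -/
theorem gradSqAt_one_sub (χ : E → ℝ) (x : E) :
    gradSqAt G (fun y ↦ 1 - χ y) x = gradSqAt G χ x := by
  have h : fderiv ℝ (fun y ↦ 1 - χ y) x = -fderiv ℝ χ x := by
    exact fderiv_const_sub 1
  rw [gradSqAt_apply, gradSqAt_apply, h, map_neg, _root_.neg_apply, map_neg, neg_neg]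

end Split

/-! ### Weights on `{x₀/2 ≤ x}` -/

/-- `e^{2σ/r} ≤ e^{4σ/x₀}` for `x₀/2 ≤ r`, `x₀ > 0`, `σ ≥ 0`. [folklore] -/
theorem exp_weight_le_of_le {σ x₀ r : ℝ} (hσ : 0 ≤ σ) (hx₀ : 0 < x₀) (h : x₀ / 2 ≤ r) :
    Real.exp (2 * σ / r) ≤ Real.exp (4 * σ / x₀) := by
  have hr : 0 < r := by linarith
  refine Real.exp_le_exp.mpr ?_
  rw [div_le_div_iff₀ hr hx₀]
  nlinarith

/-- `1 ≤ e^{2σ/r}` for `r > 0`, `σ ≥ 0`. [folklore] -/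
theorem one_le_exp_weight {σ r : ℝ} (hσ : 0 ≤ σ) (hr : 0 < r) : 1 ≤ Real.exp (2 * σ / r) :=
  Real.one_le_exp (by positivity)

/-- `(x₀/2)^k ≤ r^k e^{2σ/r}` for `x₀/2 ≤ r`, `x₀ > 0`, `σ ≥ 0`. [folklore] -/
theorem pow_weight_mul_exp_ge {σ x₀ r : ℝ} (hσ : 0 ≤ σ) (hx₀ : 0 < x₀) (h : x₀ / 2 ≤ r) (k : ℕ) :
    (x₀ / 2) ^ k ≤ Real.exp (2 * σ / r) * r ^ k := by
  have hr : 0 < r := by linarith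
  have h1 : (x₀ / 2) ^ k ≤ r ^ k := pow_le_pow_left₀ (by positivity) h k
  have h2 : r ^ k ≤ Real.exp (2 * σ / r) * r ^ k :=
    le_mul_of_one_le_left (by positivity) (one_le_exp_weight hσ hr)
  exact h1.trans h2

end MetricCoord

end Literature.Geometry.Lorentzian

end
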